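import Summits.SmoothPoincare4.SmoothPoincare4.Theorems.CongruenceShadowsAgkCor6SufficiencyNielsenFree
import Literature.Topology.FourManifolds.FlowerMelon

/-!
# Crux `AgkCor6Sufficiency` (item stmt-SmoothPoincare4-10894), line `lp-by-sphere-system-surgery`:
# vocabulary and glue for the stub `stub_geomMarking` (lead reshape r6b)

`CongruenceShadowsAgkCor6SufficiencyNielsenFree.lean` reduced the crux (Nielsen-free) to LP,
Griffiths, Dehn–Nielsen–Baer and two geometric statements, `GeomMarkingStmt` (every balanced
Gay–Kirby trisection carries a based marking with a joint-chart datum `JCD`) and `JCDStepStmt`.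
This file prepares the proof of the marking statement:

* §1 vocabulary of chart-like `2`-cells in a closed subset `F ⊆ X` (`cellPt`, `cellHole`,
  `cellCircle`, `cellDisc`, `IsChartCell F Φ O`) and of a *cell basis* (`CellBasis F Φ g`: a free
  basis of `π₁(F ∖ Φ(B(0,1)), Φ(1,0))` on `2g` letters reading the boundary circle as `r_g` — the
  `π₁` half of `JCD`), and the *punctured flower model* `PuncturedFlowerModel g` (a cell basis
  on Juhász's genus-`g` flower surface `FlowerModel.flowerSurface g ⊂ ℝ³`, the tree's model of
  the central surface for `g ≥ 2`);
* §2 `GeomMarkingStmt3k` — the marking statement restricted to balanced `(3k, k)`-trisections,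
  which is all the deciding theorem consumes (the trisection of the homotopy sphere has `g = 3k`
  by Gay–Kirby's Remark 2; the `S⁴` tower starts from the tree's genus-`0` datum and is fed by
  `JCDStepStmt` alone), so that NO genus-`1` or genus-`2` model is ever needed;
* §3 PROVED glue: `stabilizableMarking3k_of_geomMarking3k_of_jcdStep` (hypothesis (G) for
  `(3k, k)`-trisections from `GeomMarkingStmt3k` and `JCDStepStmt`, the induction of the tree's
  `stabilizableMarking_of_oneStep` run inside the class `JCD`),
  `spc4_of_forall_isStablyTrivial_of_stabilizableMarking3k` (the tree's deciding theorem with (G)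
  restricted to `g = 3k`, same proof), and `agkCor6Sufficiency_of_facts_nielsenFree3k` (+ primed
  twin): BOTH route decls from LP + Griffiths + DNB-surface + `GeomMarkingStmt3k` + `JCDStepStmt`
  — CONDITIONAL result; `geomMarkingStmt3k_of_geomMarkingStmt` records that r6's general
  statement implies the restricted one.

References: Abrams–Gay–Kirby, Geom. Topol. 22 (2018), Thm. 5 and Cor. 6 [AbramsGayKirby2018];
Gay–Kirby, Geom. Topol. 20 (2016), Def. 1, Remark 2, Def. 8, Lemma 10 [GayKirby2016]; Hatcher,
Algebraic Topology (2002), §1.2 p. 51 and Prop. 1.26 [HatcherAT2002].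
-/

set_option linter.dupNamespace false

noncomputable section

open Set Function ContinuousMap Metric
open scoped Manifold ContDiff Topology

namespace Summit.SmoothPoincare4.SmoothPoincare4.Cruxes.AgkCor6Sufficiency.LpBySphereSystemSurgery

open Literature.Topology.FourManifolds
open Literature.AlgebraicTopology.FundamentalGroup
open Literature.AlgebraicTopology.FundamentalGroup.VanKampen
open Literature.AlgebraicTopology.Homotopy
open Summit.SmoothPoincare4.SmoothPoincare4.Theses.CongruenceShadows (AgkCor6Sufficiency)

/-! ## 1. Chart-like cells and cell bases -/

section Cells

variable {X : Type} [TopologicalSpace X]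

/-- The model base point `(1, 0)` of the closed disc `B̄(0, 2) ⊂ ℝ²` (the point at which `JCD`
bases the marking: `x₀ = Φ(1, 0)`). -/
def cellPt : closedBall (0 : EuclideanSpace ℝ (Fin 2)) 2 :=
  ⟨Complex.orthonormalBasisOneI.repr 1, closedBall_subset_closedBall one_le_two (by simp)⟩

/-- The open hole `Φ(B(0,1))` of a cell `Φ`. -/
def cellHole (Φ : C(closedBall (0 : EuclideanSpace ℝ (Fin 2)) 2, X)) : Set X :=
  Φ '' {z | ‖(z : EuclideanSpace ℝ (Fin 2))‖ < 1}

/-- The boundary circle `Φ(‖z‖ = 1)` of the hole of a cell `Φ`. -/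
def cellCircle (Φ : C(closedBall (0 : EuclideanSpace ℝ (Fin 2)) 2, X)) : Set X :=
  Φ '' {z | ‖(z : EuclideanSpace ℝ (Fin 2))‖ = 1}

/-- The closed disc `Φ(B̄(0,1))` of a cell `Φ`. -/
def cellDisc (Φ : C(closedBall (0 : EuclideanSpace ℝ (Fin 2)) 2, X)) : Set X :=
  Φ '' {z | ‖(z : EuclideanSpace ℝ (Fin 2))‖ ≤ 1}

/-- **Chart-like `2`-cell in `F`** (the shape produced by the tree's `exists_chartCell_of_chart` /
`IsGKTrisection.exists_jointChart_cell`): `Φ : B̄(0,2) → X` continuous injective with image in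
`F`, and `F ∩ O = Φ(B(0,2))` for the open set `O`. -/
def IsChartCell (F : Set X) (Φ : C(closedBall (0 : EuclideanSpace ℝ (Fin 2)) 2, X))
    (O : Set X) : Prop :=
  Injective Φ ∧ range Φ ⊆ F ∧ IsOpen O ∧ F ∩ O = Φ '' {z | ‖(z : EuclideanSpace ℝ (Fin 2))‖ < 2}

/-- **Cell basis of genus `g`** for a cell `Φ` in `F` (the `π₁` half of `JCD`): `F ∖ Φ(B(0,1))` is
path connected and there are a generator `t` of `π₁` of the circle `Φ(‖z‖ = 1)` at `Φ(1,0)` and a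
free basis `θ : F⟨a₁, …, b_g⟩ ≃* π₁(F ∖ Φ(B(0,1)), Φ(1,0))` with `θ(r_g) = t` read in the
complement (Hatcher §1.2 p. 51: a closed orientable genus-`g` surface minus a disc has free
`π₁` of rank `2g` in which the boundary reads `∏ [aᵢ, bᵢ]`). -/
def CellBasis (F : Set X) (Φ : C(closedBall (0 : EuclideanSpace ℝ (Fin 2)) 2, X)) (g : ℕ) :
    Prop :=
  IsPathConnected (F \ cellHole Φ) ∧
  ∃ (hx : Φ cellPt ∈ cellCircle Φ) (hCA : cellCircle Φ ⊆ F \ cellHole Φ)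
    (t : FundamentalGroup ↥(cellCircle Φ) ⟨Φ cellPt, hx⟩)
    (θ : FreeGroup (surfaceGen g) ≃* FundamentalGroup ↥(F \ cellHole Φ) ⟨Φ cellPt, hCA hx⟩),
    Subgroup.closure {t} = ⊤ ∧
      θ (surfaceRelator g) = inclHomOfSubset hCA _ hx (hCA hx) t

end Cells

/-- **The punctured flower model of genus `g`** (statement of the registered stub
`stub_puncturedFlowerModel`, intended for `g ≥ 2`): Juhász's flower surface
`{q_g + z² = c_g} ⊂ ℝ³` (`FlowerModel.flowerSurface g`, the boundary of the tree's model
genus-`g` handlebody `FlowerModel.FlowerHandlebody`, marked by `S_g` in `FlowerMelon.lean`)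
carries a chart-like `2`-cell with a cell basis of genus `g` — the flower surface minus a disc has
free `π₁` of rank `2g` on the melon generators, the boundary circle reading `r_g`
(Hatcher §1.2 p. 51, for this explicit surface; e.g. all melon slices but the last glued along
arcs, `exists_basis_union_of_arc`, plus the last slice minus a disc glued along the seam circle,
`exists_freeBasis_union_of_closed_cover_collars`). -/
def PuncturedFlowerModel (g : ℕ) : Prop :=
  ∃ (Ψ : C(closedBall (0 : EuclideanSpace ℝ (Fin 2)) 2, ↥(FlowerModel.flowerSurface g)))
    (O : Set ↥(FlowerModel.flowerSurface g)),
    IsChartCell (univ : Set ↥(FlowerModel.flowerSurface g)) Ψ O ∧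
      CellBasis (univ : Set ↥(FlowerModel.flowerSurface g)) Ψ g

/-! ## 2. The marking statement the deciding theorem consumes -/

/-- **Geometric marking for balanced `(3k, k)`-trisections** (statement of the registered stub
`stub_geomMarking3k`; `GeomMarkingStmt` restricted to `g = 3k`, which is all that
`spc4_of_forall_isStablyTrivial_of_stabilizableMarking3k` consumes: the trisection of a homotopy
`4`-sphere has `g = 3k` by Gay–Kirby's Remark 2). -/
def GeomMarkingStmt3k : Prop :=
  ∀ (X : Type) [TopologicalSpace X] [T2Space X] [SecondCountableTopology X]
    [ChartedSpace (EuclideanSpace ℝ (Fin 4)) X] [IsManifold (𝓡 4) ∞ X] [CompactSpace X]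
    [ConnectedSpace X] (_ : SmoothOrientation (𝓡 4) X) (k : ℕ) (S : Fin 3 → Set X)
    (_ : IsBalancedGKTrisection X (3 * k) k S),
    ∃ (x₀ : centralSurface S) (μ : SurfaceGroup (3 * k) ≃* FundamentalGroup (centralSurface S) x₀),
      JCD X (3 * k) S x₀ μ

/-- The general marking statement of r6 implies the restricted one. -/
theorem geomMarkingStmt3k_of_geomMarkingStmt (hGM : GeomMarkingStmt) : GeomMarkingStmt3k :=
  fun X _ _ _ _ _ _ _ o k S h => hGM X o (3 * k) k S h

/-! ## 3. Glue (proved) -/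

/-- **(G) for `(3k, k)`-trisections from the restricted marking and the JCD step**: the induction
of the tree's `stabilizableMarking_of_oneStep` run inside the class `JCD`, with the three JCD steps
in sectors `2, 1, 0` forming one balanced step (`TrisectionKernels.stabilize_eq_stabilizeOne`),
started from `GeomMarkingStmt3k`. [cite: AbramsGayKirby2018, Def. 3 (p. 1540) and Thm. 5 (p. 1541)]
[cite: GayKirby2016, Def. 8 and Lemma 10] -/
theorem stabilizableMarking3k_of_geomMarking3k_of_jcdStep (hGM : GeomMarkingStmt3k)
    (hJ : JCDStepStmt)
    (X : Type) [TopologicalSpace X] [T2Space X] [SecondCountableTopology X]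
    [ChartedSpace (EuclideanSpace ℝ (Fin 4)) X] [IsManifold (𝓡 4) ∞ X] [CompactSpace X]
    [ConnectedSpace X] (o : SmoothOrientation (𝓡 4) X) (k : ℕ) (S : Fin 3 → Set X)
    (h : IsBalancedGKTrisection X (3 * k) k S) :
    ∃ (x₀ : centralSurface S) (μ : SurfaceGroup (3 * k) ≃* FundamentalGroup (centralSurface S) x₀),
      ∀ n : ℕ, ∃ (S' : Fin 3 → Set X) (h' : IsBalancedGKTrisection X (3 * k + 3 * n) (k + n) S')
        (x₀' : centralSurface S')
        (μ' : SurfaceGroup (3 * k + 3 * n) ≃* FundamentalGroup (centralSurface S') x₀'),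
        groupGKTrisectionOf h' x₀' μ' = (groupGKTrisectionOf h x₀ μ).stabilizeIter n := by
  -- one balanced step inside the class `JCD`, at every genus (three JCD steps)
  have hP₁ : ∀ (g k : ℕ) (S : Fin 3 → Set X) (h : IsBalancedGKTrisection X g k S)
      (x₀ : centralSurface S) (μ : SurfaceGroup g ≃* FundamentalGroup (centralSurface S) x₀),
      JCD X g S x₀ μ →
      ∃ (S' : Fin 3 → Set X) (h' : IsBalancedGKTrisection X (g + 3) (k + 1) S')
        (x₀' : centralSurface S')
        (μ' : SurfaceGroup (g + 3) ≃* FundamentalGroup (centralSurface S') x₀'),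
        JCD X (g + 3) S' x₀' μ' ∧
          groupGKTrisectionOf h' x₀' μ' = (groupGKTrisectionOf h x₀ μ).stabilize := by
    intro g k S h x₀ μ hd
    have transport : ∀ {g' : ℕ} {kv kv' : Fin 3 → ℕ} (_ : kv = kv') {S' : Fin 3 → Set X}
        (h' : IsGKTrisection X g' kv S') (x : centralSurface S')
        (μ : SurfaceGroup g' ≃* FundamentalGroup (centralSurface S') x),
        JCD X g' S' x μ →
          ∃ h'' : IsGKTrisection X g' kv' S',
            JCD X g' S' x μ ∧ groupGKTrisectionOf h'' x μ = groupGKTrisectionOf h' x μ := by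
      intro g' kv kv' e
      subst e
      intro S' h' x μ hg
      exact ⟨h', hg, rfl⟩
    obtain ⟨S₁, h₁, x₁, μ₁, hd₁, e₁⟩ := hJ X 2 g (fun _ => k) S h x₀ μ hd
    obtain ⟨S₂, h₂, x₂, μ₂, hd₂, e₂⟩ := hJ X 1 (g + 1) _ S₁ h₁ x₁ μ₁ hd₁
    obtain ⟨S₃, h₃, x₃, μ₃, hd₃, e₃⟩ := hJ X 0 (g + 1 + 1) _ S₂ h₂ x₂ μ₂ hd₂
    have ek : Function.update (Function.update (Function.update (fun _ : Fin 3 => k) 2 (k + 1)) 1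
        (Function.update (fun _ : Fin 3 => k) 2 (k + 1) 1 + 1)) 0
        (Function.update (Function.update (fun _ : Fin 3 => k) 2 (k + 1)) 1
          (Function.update (fun _ : Fin 3 => k) 2 (k + 1) 1 + 1) 0 + 1) = fun _ => k + 1 := by
      funext m
      fin_cases m <;> simp
    obtain ⟨h', hd', e'⟩ := transport ek h₃ x₃ μ₃ hd₃
    refine ⟨S₃, h', x₃, μ₃, hd', ?_⟩
    rw [e', TrisectionKernels.stabilize_eq_stabilizeOne, ← e₁, ← e₂, ← e₃]
  -- the induction from the `(3k, k)` datum
  obtain ⟨x₀, μ, hμ⟩ := hGM X o k S h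
  refine ⟨x₀, μ, fun n => ?_⟩
  suffices H : ∃ (S' : Fin 3 → Set X) (h' : IsBalancedGKTrisection X (3 * k + 3 * n) (k + n) S')
      (x₀' : centralSurface S')
      (μ' : SurfaceGroup (3 * k + 3 * n) ≃* FundamentalGroup (centralSurface S') x₀'),
      JCD X (3 * k + 3 * n) S' x₀' μ' ∧
        groupGKTrisectionOf h' x₀' μ' = (groupGKTrisectionOf h x₀ μ).stabilizeIter n by
    obtain ⟨S', h', x₀', μ', -, hEq⟩ := H
    exact ⟨S', h', x₀', μ', hEq⟩
  induction n with
  | zero => exact ⟨S, h, x₀, μ, hμ, rfl⟩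
  | succ n ih =>
    obtain ⟨Sₙ, hₙ, xₙ, μₙ, hPₙ, hK⟩ := ih
    obtain ⟨S', h', x', μ', hP', hEq⟩ := hP₁ (3 * k + 3 * n) (k + n) Sₙ hₙ xₙ μₙ hPₙ
    refine ⟨S', h', x', μ', hP', ?_⟩
    rw [hEq, hK]
    rfl

/-- **Abrams–Gay–Kirby 2018, Cor. 6, direction "every `(3k, k)`-trisection of the trivial group is
stably trivial ⇒ SPC4", from Gay–Kirby Thm. 4, rigidity (b′), the standard trisections of `S⁴`
(d′) and ONE stabilisable based marking per balanced `(3k, k)`-trisection** — the tree's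
`spc4_of_forall_isStablyTrivial_of_stabilizableMarking` with hypothesis (G) restricted to the
trisections the proof actually meets (`g = 3k` by Gay–Kirby's Remark 2,
`gkTrisection_genus_eq_sum_of_homotopyEquiv_sphere_holds`); same proof.
[cite: AbramsGayKirby2018, Cor. 6 (p. 1541); Thm. 5 (p. 1541)] [cite: GayKirby2016, Remark 2] -/
theorem spc4_of_forall_isStablyTrivial_of_stabilizableMarking3k
    (hGK : exists_isBalancedGKTrisection.{0})
    (hb : diffeomorph_of_iso_groupGKTrisectionOf.{0})
    (hd : sphere_gkTrisections)
    (hG : ∀ (X : Type) [TopologicalSpace X] [T2Space X] [SecondCountableTopology X]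
      [ChartedSpace (EuclideanSpace ℝ (Fin 4)) X] [IsManifold (𝓡 4) ∞ X] [CompactSpace X]
      [ConnectedSpace X] (_ : SmoothOrientation (𝓡 4) X) (k : ℕ) (S : Fin 3 → Set X)
      (h : IsBalancedGKTrisection X (3 * k) k S),
      ∃ (x₀ : centralSurface S) (μ : SurfaceGroup (3 * k) ≃* FundamentalGroup (centralSurface S) x₀),
        ∀ n : ℕ, ∃ (S' : Fin 3 → Set X) (h' : IsBalancedGKTrisection X (3 * k + 3 * n) (k + n) S')
          (x₀' : centralSurface S')
          (μ' : SurfaceGroup (3 * k + 3 * n) ≃* FundamentalGroup (centralSurface S') x₀'),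
          groupGKTrisectionOf h' x₀' μ' = (groupGKTrisectionOf h x₀ μ).stabilizeIter n)
    (hst : ∀ (k : ℕ) (K : TrisectionKernels (3 * k)),
      IsGroupTrisection (3 * k) k (PUnit : Type) K → K.IsStablyTrivial)
    (M : Type) [TopologicalSpace M] [T2Space M] [SecondCountableTopology M] :
    ContinuousMap.HomotopyEquiv.NonemptyDiffeomorphSphere M 4 := by
  have hχ : gkTrisection_genus_eq_sum_of_homotopyEquiv_sphere.{0} :=
    gkTrisection_genus_eq_sum_of_homotopyEquiv_sphere_holds
  intro _ _ e
  -- packaging of `M ≃ₕ S⁴` (all proved in the tree)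
  haveI : CompactSpace M := compactSpace_of_homotopyEquiv_sphere_four_holds M e
  obtain ⟨o⟩ := isOrientable_of_homotopyEquiv_sphere_four_holds M e
  haveI : SimplyConnectedSpace (Metric.sphere (0 : EuclideanSpace ℝ (Fin 5)) 1) :=
    simplyConnectedSpace_sphere_four_holds
  haveI : SimplyConnectedSpace M := e.simplyConnectedSpace
  obtain ⟨o'⟩ := isOrientable_sphere_holds 4
  -- trisect `M`; `χ = 2` forces `g = 3k`
  obtain ⟨g, k, S, -, hS⟩ := hGK M o
  obtain rfl : g = 3 * k := hχ.balanced M o hS e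
  -- the stabilisable based marking of (G); its kernel triple is a `(3k, k)` trisection of `1`
  obtain ⟨x₀, μ, hμ⟩ := hG M o k S hS
  have hK : IsGroupTrisection (3 * k) k (PUnit : Type) (groupGKTrisectionOf hS x₀ μ) :=
    (isGroupTrisection_groupGKTrisectionOf_holds.{0} M o (3 * k) k S hS x₀ μ).punit_of_subsingleton
  -- the hypothesis: stably trivial
  obtain ⟨n, m, hnm, hiso⟩ := hst k _ hK
  -- realise `K.stabilizeIter n` on the nose by a trisection of `M`
  obtain ⟨Sₙ, hₙ, xₙ, μₙ, hEq⟩ := hμ n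
  rw [← hEq] at hiso
  -- the `(3 + 3m, 1 + m)`-trisection of `S⁴`, and rigidity
  obtain ⟨S', hS', x', μ', hiso'⟩ := hd m
  exact nonempty_diffeomorph_sphere_of_iso_cast hb o o' hₙ xₙ μₙ hS' x' μ' _ hiso' hnm
    (by omega) hiso

/-- **The crux of route `CongruenceShadows` from LP, Griffiths, DNB-surface, the RESTRICTED marking
statement and the JCD step** — CONDITIONAL result (r6b: no genus-`1`/`2` model needed).
[cite: AbramsGayKirby2018, Cor. 6 and Thm. 5 (p. 1541)] -/
theorem agkCor6Sufficiency_of_facts_nielsenFree3k (hLP : exists_diffeomorph_comp_incl_eq.{0})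
    (hGr : GriffithsExtension) (hDS : DehnNielsenBaerSurfaceSmooth) (hGM : GeomMarkingStmt3k)
    (hJ : JCDStepStmt) : AgkCor6Sufficiency :=
  fun hst M _ _ _ =>
    spc4_of_forall_isStablyTrivial_of_stabilizableMarking3k exists_isBalancedGKTrisection_holds
      (rigidity_of_facts hLP hGr hDS) (sphere_gkTrisections_of_jcdStep hJ)
      (stabilizableMarking3k_of_geomMarking3k_of_jcdStep hGM hJ) hst M

/-- **The same for the shared decl of route `GroupTrisection`** — CONDITIONAL result.
[cite: AbramsGayKirby2018, Cor. 6 and Thm. 5 (p. 1541)] -/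
theorem agkCor6Sufficiency'_of_facts_nielsenFree3k (hLP : exists_diffeomorph_comp_incl_eq.{0})
    (hGr : GriffithsExtension) (hDS : DehnNielsenBaerSurfaceSmooth) (hGM : GeomMarkingStmt3k)
    (hJ : JCDStepStmt) :
    Summit.SmoothPoincare4.SmoothPoincare4.Theses.GroupTrisection.AgkCor6Sufficiency :=
  fun hst M _ _ _ =>
    spc4_of_forall_isStablyTrivial_of_stabilizableMarking3k exists_isBalancedGKTrisection_holds
      (rigidity_of_facts hLP hGr hDS) (sphere_gkTrisections_of_jcdStep hJ)
      (stabilizableMarking3k_of_geomMarking3k_of_jcdStep hGM hJ) hst M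

end Summit.SmoothPoincare4.SmoothPoincare4.Cruxes.AgkCor6Sufficiency.LpBySphereSystemSurgery

end
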